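import Summits.AtomisticToContinuum.Crystallization.Theorems.ExcessDecayLiouvilleGiaquinta

/-!
# Route `ExcessDecayLiouville`: Giaquinta's iteration lemma with a general exponent

Ingredient of the nonlinear Caccioppoli estimate for item `ExcessDecay` (stmt-AtomisticToContinuum-9334):
the absorption lemma of `ExcessDecayLiouvilleGiaquinta.lean` with the gap entering through an arbitrary power
`m` (the far-field junk of the lattice estimates decays like `(t − s)^{-k}` for several `k ≤ 13`, and a term
`X/(t−s)^k` is `X (b−a)^{m−k}/(t−s)^m`).  With the absorption factor `θ = 2^{-(m+1)}` and the ratio `τ = 1/2`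
the two geometric series are explicit:

if `Z s ≤ 2^{-(m+1)} Z t + A/(t−s)^m + B` for all `a ≤ s < t ≤ b` and `Z` is bounded on `[a, b]`, then
`Z s ≤ 2^{m+1} A/(t−s)^m + 2B` (`giaquinta_iteration_pow`).
All `[folklore]`; helper lemmas, nothing here closes an item.
-/

noncomputable section

namespace Summit.AtomisticToContinuum.Crystallization.Theorems.ExcessDecayLiouville

open scoped BigOperators Topology

/-- The finite iteration with exponent `m`: along `s_i = t − τ^i (t − s)`,
`Z s ≤ θ^k Z(s_k) + Σ_{i<k} θ^i (A/((1−τ)^m τ^{m i} (t−s)^m) + B)`. [folklore] -/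
theorem giaquinta_step_pow (m : ℕ) {Z : ℝ → ℝ} {a b θ A B : ℝ} (hθ : 0 ≤ θ)
    (h : ∀ s t : ℝ, a ≤ s → s < t → t ≤ b → Z s ≤ θ * Z t + A / (t - s) ^ m + B)
    {τ : ℝ} (hτ0 : 0 < τ) (hτ1 : τ < 1) {s t : ℝ} (has : a ≤ s) (hst : s < t) (htb : t ≤ b) (k : ℕ) :
    Z s ≤ θ ^ k * Z (t - τ ^ k * (t - s)) +
      ∑ i ∈ Finset.range k, θ ^ i * (A / ((1 - τ) ^ m * τ ^ (m * i) * (t - s) ^ m) + B) := by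
  induction k with
  | zero => simp
  | succ k ih =>
    have hts : 0 < t - s := sub_pos.2 hst
    have hτk : 0 < τ ^ k := pow_pos hτ0 k
    have hsk_ge : a ≤ t - τ ^ k * (t - s) := by
      have : τ ^ k * (t - s) ≤ 1 * (t - s) :=
        mul_le_mul_of_nonneg_right (pow_le_one₀ hτ0.le hτ1.le) hts.le
      linarith
    have hlt : t - τ ^ k * (t - s) < t - τ ^ (k + 1) * (t - s) := by
      have : τ ^ (k + 1) * (t - s) < τ ^ k * (t - s) := by
        rw [pow_succ]
        have : τ ^ k * τ < τ ^ k * 1 := mul_lt_mul_of_pos_left hτ1 hτk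
        nlinarith
      linarith
    have hle : t - τ ^ (k + 1) * (t - s) ≤ b := by
      have : 0 ≤ τ ^ (k + 1) * (t - s) := by positivity
      linarith
    have hk := h _ _ hsk_ge hlt hle
    have hgap : (t - τ ^ (k + 1) * (t - s)) - (t - τ ^ k * (t - s)) = (1 - τ) * τ ^ k * (t - s) := by ring
    rw [hgap] at hk
    have hθk : 0 ≤ θ ^ k := pow_nonneg hθ k
    have hmul := mul_le_mul_of_nonneg_left hk hθk
    rw [Finset.sum_range_succ]
    have e1 : θ ^ k * (θ * Z (t - τ ^ (k + 1) * (t - s)) + A / ((1 - τ) * τ ^ k * (t - s)) ^ m + B) =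
        θ ^ (k + 1) * Z (t - τ ^ (k + 1) * (t - s)) +
          θ ^ k * (A / ((1 - τ) ^ m * τ ^ (m * k) * (t - s) ^ m) + B) := by
      rw [pow_succ, pow_mul, mul_pow, mul_pow, ← pow_mul, ← pow_mul, mul_comm k m]; ring
    rw [e1] at hmul
    linarith [ih, hmul]

/-- **Giaquinta's iteration lemma with exponent `m`** (absorption factor `2^{-(m+1)}`). [folklore] -/
theorem giaquinta_iteration_pow (m : ℕ) {Z : ℝ → ℝ} {a b A B M : ℝ} (hA : 0 ≤ A) (hB : 0 ≤ B)
    (hZM : ∀ ρ : ℝ, a ≤ ρ → ρ ≤ b → Z ρ ≤ M)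
    (h : ∀ s t : ℝ, a ≤ s → s < t → t ≤ b → Z s ≤ (1 / 2) ^ (m + 1) * Z t + A / (t - s) ^ m + B)
    {s t : ℝ} (has : a ≤ s) (hst : s < t) (htb : t ≤ b) :
    Z s ≤ 2 ^ (m + 1) * (A / (t - s) ^ m) + 2 * B := by
  have hθ : (0 : ℝ) ≤ (1 / 2) ^ (m + 1) := by positivity
  have hθ1 : ((1 / 2 : ℝ)) ^ (m + 1) < 1 := pow_lt_one₀ (by norm_num) (by norm_num) (by omega)
  have hts : 0 < t - s := sub_pos.2 hst
  -- the bound for every k, with τ = 1/2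
  set K₀ : ℝ := 2 ^ (m + 1) * (A / (t - s) ^ m) + 2 * B with hK₀
  have hstep : ∀ k : ℕ, Z s ≤ ((1 / 2 : ℝ) ^ (m + 1)) ^ k * M + K₀ := by
    intro k
    have hk := giaquinta_step_pow m hθ h (τ := 1 / 2) (by norm_num) (by norm_num) has hst htb k
    have hsk_ge : a ≤ t - (1 / 2 : ℝ) ^ k * (t - s) := by
      have : (1 / 2 : ℝ) ^ k * (t - s) ≤ 1 * (t - s) :=
        mul_le_mul_of_nonneg_right (pow_le_one₀ (by norm_num) (by norm_num)) hts.le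
      linarith
    have hsk_le : t - (1 / 2 : ℝ) ^ k * (t - s) ≤ b := by
      have : 0 ≤ (1 / 2 : ℝ) ^ k * (t - s) := by positivity
      linarith
    have hZk := hZM _ hsk_ge hsk_le
    have h1 : ((1 / 2 : ℝ) ^ (m + 1)) ^ k * Z (t - (1 / 2 : ℝ) ^ k * (t - s)) ≤ ((1 / 2 : ℝ) ^ (m + 1)) ^ k * M :=
      mul_le_mul_of_nonneg_left hZk (pow_nonneg hθ k)
    -- each summand: θ^i A/((1/2)^m (1/2)^{m i} (t−s)^m) = 2^m (1/2)^i A/(t−s)^m, and θ^i B ≤ (1/2)^i B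
    have hterm : ∀ i : ℕ, ((1 / 2 : ℝ) ^ (m + 1)) ^ i *
        (A / ((1 - 1 / 2) ^ m * (1 / 2 : ℝ) ^ (m * i) * (t - s) ^ m) + B) ≤
        (1 / 2 : ℝ) ^ i * (2 ^ m * (A / (t - s) ^ m) + B) := by
      intro i
      have e1 : ((1 / 2 : ℝ) ^ (m + 1)) ^ i * (A / ((1 - 1 / 2) ^ m * (1 / 2 : ℝ) ^ (m * i) * (t - s) ^ m)) =
          (1 / 2 : ℝ) ^ i * (2 ^ m * (A / (t - s) ^ m)) := by
        have h2 : (1 - 1 / 2 : ℝ) = 1 / 2 := by norm_num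
        rw [h2, ← pow_mul, pow_mul, ← pow_add]
        have hne : ((1 / 2 : ℝ)) ^ (m + m * i) ≠ 0 := by positivity
        have hts0 : (t - s) ^ m ≠ 0 := by positivity
        field_simp
        rw [← pow_mul]
        have e3 : (1 / 2 : ℝ) ^ (m + m * i) * (1 / 2) ^ i * 2 ^ m = (1 / 2 : ℝ) ^ ((m + 1) * i) := by
          rw [pow_add, show (m + 1) * i = m * i + i by ring, pow_add]
          have h12 : (1 / 2 : ℝ) ^ m * 2 ^ m = 1 := by rw [← mul_pow]; norm_num
          calc (1 / 2 : ℝ) ^ m * (1 / 2) ^ (m * i) * (1 / 2) ^ i * 2 ^ m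
              = ((1 / 2 : ℝ) ^ m * 2 ^ m) * ((1 / 2) ^ (m * i) * (1 / 2) ^ i) := by ring
            _ = (1 / 2 : ℝ) ^ (m * i) * (1 / 2) ^ i := by rw [h12, one_mul]
        calc ((1 / 2 : ℝ) ^ ((m + 1) * i)) * A = A * (1 / 2 : ℝ) ^ ((m + 1) * i) := mul_comm _ _
          _ = A * ((1 / 2 : ℝ) ^ (m + m * i) * (1 / 2) ^ i * 2 ^ m) := by rw [e3]
          _ = A * (1 / 2 : ℝ) ^ (m + m * i) * (1 / 2) ^ i * 2 ^ m := by ring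
      have e2 : ((1 / 2 : ℝ) ^ (m + 1)) ^ i * B ≤ (1 / 2 : ℝ) ^ i * B := by
        refine mul_le_mul_of_nonneg_right ?_ hB
        rw [← pow_mul]
        exact pow_le_pow_of_le_one (by norm_num) (by norm_num) (by nlinarith)
      rw [mul_add, mul_add, e1]
      linarith
    have hsum : ∑ i ∈ Finset.range k, ((1 / 2 : ℝ) ^ (m + 1)) ^ i *
        (A / ((1 - 1 / 2) ^ m * (1 / 2 : ℝ) ^ (m * i) * (t - s) ^ m) + B) ≤ K₀ := by
      refine (Finset.sum_le_sum fun i _ => hterm i).trans ?_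
      rw [← Finset.sum_mul]
      have hg := geom_partial_sum_le (q := (1 / 2 : ℝ)) (by norm_num) (by norm_num) k
      have hc : 0 ≤ 2 ^ m * (A / (t - s) ^ m) + B := by positivity
      calc (∑ i ∈ Finset.range k, (1 / 2 : ℝ) ^ i) * (2 ^ m * (A / (t - s) ^ m) + B)
          ≤ (1 / (1 - 1 / 2)) * (2 ^ m * (A / (t - s) ^ m) + B) := mul_le_mul_of_nonneg_right hg hc
        _ = K₀ := by rw [hK₀, pow_succ]; ring
    linarith [hk, h1, hsum]
  -- let k → ∞
  by_contra hcon
  push Not at hcon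
  rcases le_or_gt M 0 with hM | hM
  · have := hstep 0
    simp only [pow_zero, one_mul] at this
    linarith
  · obtain ⟨k, hk⟩ := exists_pow_lt_of_lt_one (div_pos (sub_pos.2 hcon) hM) hθ1
    have := hstep k
    have h2 : ((1 / 2 : ℝ) ^ (m + 1)) ^ k * M < Z s - K₀ := by
      have := (lt_div_iff₀ hM).1 hk
      linarith
    linarith

end Summit.AtomisticToContinuum.Crystallization.Theorems.ExcessDecayLiouville

end
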